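import Summits.Ventures.DiscreteObjects.Hadamard.PrimeOrder17to47

/-!
# Hadamard 668 census, family F12 — the fixed substructures of automorphisms of order 23, 37, 41, 83 (kernel)

Framing: lottery ticket; floor = certified bounds/negative ranges.

Cell pub-namedobj (venture DiscreteObjects), target (H), hadamard gen 6.  The surviving primes `23, 37, 41, 83` of the
prime-order spectrum (FAMILY-F12-G5 §9) come with FORCED orbit numbers and FORCED fixed substructures, which were the paper
premises of the orbit-matrix searches of gens 5–6 ((37,9), (37,6), Z₈₃ full orbit matrices, Z₄₁ stage 1).  This file proves them
in the kernel for a `0/1` incidence function `N : P → B → ℤ` with `|P| = |B| = 667`, row and column sums `333`, inner products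
`166` of distinct rows and of distinct columns, and an automorphism pair `(ρ, τ)`, `ρ^p = τ^p = 1`, `ρ ≠ 1`
(Cauchy–Schwarz tables `cs41`, `cs83`, `cs37`, `cs23` by `decide`, then `FixedStructure`):
* `p = 41` (`fixedSubstructure_41`): `16 + 16` orbits, `11` fixed points and `11` fixed blocks, every fixed point on exactly `5`
  fixed blocks, every fixed block through exactly `5` fixed points, two fixed points share exactly `2` fixed blocks and dually —
  the parameters of the `2-(11,5,2)` biplane;
* `p = 83` (`fixedSubstructure_83`): `8 + 8` orbits, `3 + 3` fixed elements, each fixed point on exactly one fixed block and vice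
  versa, two fixed points share no fixed block (a permutation);
* `p = 37` (`fixedSubstructure_37`): `18 + 18` orbits, one fixed point, one fixed block, NOT incident (anti-flag);
* `p = 23` (`fixedSubstructure_23`): either `28 + 28` orbits with `23 + 23` fixed elements forming a `2-(23,11,5)`-parameter
  structure (`c = 11`, `u = 5` on both sides) or `29 + 29` orbits fixed-point-free on both sides — the mixed case is impossible
  (a fixed block would carry `≡ 11 (mod 23)` fixed points).
Ours, not literature; no `sorry`.
-/

open Finset BigOperators

namespace Summit.Ventures.DiscreteObjects.Hadamard

variable {P B : Type*} [Fintype P] [DecidableEq P] [Fintype B] [DecidableEq B]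

set_option maxRecDepth 100000 in
/-- `p = 41`: every orbit number except `16` has negative discriminant -/
lemma cs41 : ∀ m ∈ Finset.range 17, 1 ≤ m → m ≠ 16 →
    (0 : ℤ) < 4 * (333 ^ 2 - (m : ℤ) * (167 + 166 * 41)) - (666 - (m : ℤ) * 41) ^ 2 := by decide

set_option maxRecDepth 100000 in
/-- `p = 83`: every orbit number except `8` has negative discriminant -/
lemma cs83 : ∀ m ∈ Finset.range 9, 1 ≤ m → m ≠ 8 →
    (0 : ℤ) < 4 * (333 ^ 2 - (m : ℤ) * (167 + 166 * 83)) - (666 - (m : ℤ) * 83) ^ 2 := by decide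

set_option maxRecDepth 100000 in
/-- `p = 37`: every orbit number except `18` has negative discriminant -/
lemma cs37 : ∀ m ∈ Finset.range 19, 1 ≤ m → m ≠ 18 →
    (0 : ℤ) < 4 * (333 ^ 2 - (m : ℤ) * (167 + 166 * 37)) - (666 - (m : ℤ) * 37) ^ 2 := by decide

set_option maxRecDepth 100000 in
/-- `p = 23`: every orbit number except `28, 29` has negative discriminant -/
lemma cs23 : ∀ m ∈ Finset.range 30, 1 ≤ m → m ≠ 28 → m ≠ 29 →
    (0 : ℤ) < 4 * (333 ^ 2 - (m : ℤ) * (167 + 166 * 23)) - (666 - (m : ℤ) * 23) ^ 2 := by decide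

/-- one side, `p = 41`: `11` fixed blocks; a fixed point lies on exactly `5` of them; two fixed points share exactly `2` -/
lemma side41 (N : P → B → ℤ) (h01 : ∀ x y, N x y = 0 ∨ N x y = 1)
    (hrow : ∀ x, ∑ y, N x y = 333) (hpair : ∀ x x', x ≠ x' → ∑ y, N x y * N x' y = 166)
    (hB : Fintype.card B = 667)
    (ρ : Equiv.Perm P) (τ : Equiv.Perm B) (hN : ∀ x y, N (ρ x) (τ y) = N x y)
    (hρ : ρ ^ 41 = 1) (hτ : τ ^ 41 = 1) (x₀ : P) (hx₀ : ρ x₀ ≠ x₀) :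
    (univ.filter fun y => τ y = y).card = 11 ∧
    (∀ x, ρ x = x → ∑ y ∈ univ.filter (fun y => τ y = y), N x y = 5) ∧
    (∀ x x', ρ x = x → ρ x' = x' → x ≠ x' → ∑ y ∈ univ.filter (fun y => τ y = y), N x y * N x' y = 2) := by
  have hp : (41 : ℕ).Prime := by norm_num
  obtain ⟨hm1, σ, cs⟩ := orbitCount_cs N h01 hrow hpair 41 hp ρ τ hN hρ hτ x₀ hx₀
  have hcnt := card_fixed_add_classes τ hp hτ
  rw [hB] at hcnt
  set m := (blockClasses τ 41).card with hmdef
  have hm : m = 16 := by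
    by_contra hne
    exact cs_contra m 41 σ (by exact_mod_cast cs) (cs41 m (Finset.mem_range.mpr (by omega)) hm1 hne)
  have hF : (univ.filter fun y => τ y = y).card = 11 := by omega
  refine ⟨hF, fun x hx => ?_, fun x x' hx hx' hxx' => ?_⟩
  · obtain ⟨a, ha⟩ := fixedPoint_row N hrow hp ρ τ hN hτ hx
    obtain ⟨c0, c1⟩ := fixedCount_bounds N h01 τ x
    rw [hF] at c1; push_cast at ha c1; omega
  · obtain ⟨a, ha⟩ := fixedPoint_row N hrow hp ρ τ hN hτ hx
    obtain ⟨c0, c1⟩ := fixedCount_bounds N h01 τ x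
    obtain ⟨t, ht⟩ := fixedPair N hp ρ τ hN hτ hx hx' (hpair x x' hxx')
    obtain ⟨u0, u1⟩ := pairCount_bounds N h01 τ x x'
    rw [hF] at c1; push_cast at ha c1 ht; omega

/-- **Order 41: the fixed substructure has the parameters of the `2-(11,5,2)` biplane** (both sides). -/
theorem fixedSubstructure_41 (N : P → B → ℤ) (h01 : ∀ x y, N x y = 0 ∨ N x y = 1)
    (hrow : ∀ x, ∑ y, N x y = 333) (hpair : ∀ x x', x ≠ x' → ∑ y, N x y * N x' y = 166)
    (hcol : ∀ y, ∑ x, N x y = 333) (hcpair : ∀ y y', y ≠ y' → ∑ x, N x y * N x y' = 166)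
    (hP : Fintype.card P = 667) (hB : Fintype.card B = 667)
    (ρ : Equiv.Perm P) (τ : Equiv.Perm B) (hN : ∀ x y, N (ρ x) (τ y) = N x y)
    (hρ : ρ ^ 41 = 1) (hτ : τ ^ 41 = 1) (x₀ : P) (hx₀ : ρ x₀ ≠ x₀) :
    ((univ.filter fun y => τ y = y).card = 11 ∧
      (∀ x, ρ x = x → ∑ y ∈ univ.filter (fun y => τ y = y), N x y = 5) ∧
      (∀ x x', ρ x = x → ρ x' = x' → x ≠ x' → ∑ y ∈ univ.filter (fun y => τ y = y), N x y * N x' y = 2)) ∧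
    ((univ.filter fun x => ρ x = x).card = 11 ∧
      (∀ y, τ y = y → ∑ x ∈ univ.filter (fun x => ρ x = x), N x y = 5) ∧
      (∀ y y', τ y = y → τ y' = y' → y ≠ y' → ∑ x ∈ univ.filter (fun x => ρ x = x), N x y * N x y' = 2)) := by
  obtain ⟨y₀, hy₀⟩ := exists_moved_block N h01 hrow hpair ρ τ hN hx₀
  exact ⟨side41 N h01 hrow hpair hB ρ τ hN hρ hτ x₀ hx₀,
    side41 (fun y x => N x y) (fun y x => h01 x y) hcol hcpair hP τ ρ (fun y x => hN x y) hτ hρ y₀ hy₀⟩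

/-- one side, `p = 83`: `3` fixed blocks; a fixed point lies on exactly one; two fixed points share none -/
lemma side83 (N : P → B → ℤ) (h01 : ∀ x y, N x y = 0 ∨ N x y = 1)
    (hrow : ∀ x, ∑ y, N x y = 333) (hpair : ∀ x x', x ≠ x' → ∑ y, N x y * N x' y = 166)
    (hB : Fintype.card B = 667)
    (ρ : Equiv.Perm P) (τ : Equiv.Perm B) (hN : ∀ x y, N (ρ x) (τ y) = N x y)
    (hρ : ρ ^ 83 = 1) (hτ : τ ^ 83 = 1) (x₀ : P) (hx₀ : ρ x₀ ≠ x₀) :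
    (univ.filter fun y => τ y = y).card = 3 ∧
    (∀ x, ρ x = x → ∑ y ∈ univ.filter (fun y => τ y = y), N x y = 1) ∧
    (∀ x x', ρ x = x → ρ x' = x' → x ≠ x' → ∑ y ∈ univ.filter (fun y => τ y = y), N x y * N x' y = 0) := by
  have hp : (83 : ℕ).Prime := by norm_num
  obtain ⟨hm1, σ, cs⟩ := orbitCount_cs N h01 hrow hpair 83 hp ρ τ hN hρ hτ x₀ hx₀
  have hcnt := card_fixed_add_classes τ hp hτ
  rw [hB] at hcnt
  set m := (blockClasses τ 83).card with hmdef
  have hm : m = 8 := by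
    by_contra hne
    exact cs_contra m 83 σ (by exact_mod_cast cs) (cs83 m (Finset.mem_range.mpr (by omega)) hm1 hne)
  have hF : (univ.filter fun y => τ y = y).card = 3 := by omega
  refine ⟨hF, fun x hx => ?_, fun x x' hx hx' hxx' => ?_⟩
  · obtain ⟨a, ha⟩ := fixedPoint_row N hrow hp ρ τ hN hτ hx
    obtain ⟨c0, c1⟩ := fixedCount_bounds N h01 τ x
    rw [hF] at c1; push_cast at ha c1; omega
  · obtain ⟨a, ha⟩ := fixedPoint_row N hrow hp ρ τ hN hτ hx
    obtain ⟨c0, c1⟩ := fixedCount_bounds N h01 τ x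
    obtain ⟨t, ht⟩ := fixedPair N hp ρ τ hN hτ hx hx' (hpair x x' hxx')
    obtain ⟨u0, u1⟩ := pairCount_bounds N h01 τ x x'
    rw [hF] at c1; push_cast at ha c1 ht; omega

/-- **Order 83: `8 + 8` orbits, `3 + 3` fixed elements forming a permutation** (both sides). -/
theorem fixedSubstructure_83 (N : P → B → ℤ) (h01 : ∀ x y, N x y = 0 ∨ N x y = 1)
    (hrow : ∀ x, ∑ y, N x y = 333) (hpair : ∀ x x', x ≠ x' → ∑ y, N x y * N x' y = 166)
    (hcol : ∀ y, ∑ x, N x y = 333) (hcpair : ∀ y y', y ≠ y' → ∑ x, N x y * N x y' = 166)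
    (hP : Fintype.card P = 667) (hB : Fintype.card B = 667)
    (ρ : Equiv.Perm P) (τ : Equiv.Perm B) (hN : ∀ x y, N (ρ x) (τ y) = N x y)
    (hρ : ρ ^ 83 = 1) (hτ : τ ^ 83 = 1) (x₀ : P) (hx₀ : ρ x₀ ≠ x₀) :
    ((univ.filter fun y => τ y = y).card = 3 ∧
      (∀ x, ρ x = x → ∑ y ∈ univ.filter (fun y => τ y = y), N x y = 1) ∧
      (∀ x x', ρ x = x → ρ x' = x' → x ≠ x' → ∑ y ∈ univ.filter (fun y => τ y = y), N x y * N x' y = 0)) ∧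
    ((univ.filter fun x => ρ x = x).card = 3 ∧
      (∀ y, τ y = y → ∑ x ∈ univ.filter (fun x => ρ x = x), N x y = 1) ∧
      (∀ y y', τ y = y → τ y' = y' → y ≠ y' → ∑ x ∈ univ.filter (fun x => ρ x = x), N x y * N x y' = 0)) := by
  obtain ⟨y₀, hy₀⟩ := exists_moved_block N h01 hrow hpair ρ τ hN hx₀
  exact ⟨side83 N h01 hrow hpair hB ρ τ hN hρ hτ x₀ hx₀,
    side83 (fun y x => N x y) (fun y x => h01 x y) hcol hcpair hP τ ρ (fun y x => hN x y) hτ hρ y₀ hy₀⟩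

/-- one side, `p = 37`: exactly one fixed block, and no fixed point lies on it -/
lemma side37 (N : P → B → ℤ) (h01 : ∀ x y, N x y = 0 ∨ N x y = 1)
    (hrow : ∀ x, ∑ y, N x y = 333) (hpair : ∀ x x', x ≠ x' → ∑ y, N x y * N x' y = 166)
    (hB : Fintype.card B = 667)
    (ρ : Equiv.Perm P) (τ : Equiv.Perm B) (hN : ∀ x y, N (ρ x) (τ y) = N x y)
    (hρ : ρ ^ 37 = 1) (hτ : τ ^ 37 = 1) (x₀ : P) (hx₀ : ρ x₀ ≠ x₀) :
    (univ.filter fun y => τ y = y).card = 1 ∧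
    (∀ x, ρ x = x → ∑ y ∈ univ.filter (fun y => τ y = y), N x y = 0) := by
  have hp : (37 : ℕ).Prime := by norm_num
  obtain ⟨hm1, σ, cs⟩ := orbitCount_cs N h01 hrow hpair 37 hp ρ τ hN hρ hτ x₀ hx₀
  have hcnt := card_fixed_add_classes τ hp hτ
  rw [hB] at hcnt
  set m := (blockClasses τ 37).card with hmdef
  have hm : m = 18 := by
    by_contra hne
    exact cs_contra m 37 σ (by exact_mod_cast cs) (cs37 m (Finset.mem_range.mpr (by omega)) hm1 hne)
  have hF : (univ.filter fun y => τ y = y).card = 1 := by omega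
  refine ⟨hF, fun x hx => ?_⟩
  obtain ⟨a, ha⟩ := fixedPoint_row N hrow hp ρ τ hN hτ hx
  obtain ⟨c0, c1⟩ := fixedCount_bounds N h01 τ x
  rw [hF] at c1; push_cast at ha c1; omega

/-- **Order 37: `18 + 18` orbits, one fixed point and one fixed block, not incident** (both sides). -/
theorem fixedSubstructure_37 (N : P → B → ℤ) (h01 : ∀ x y, N x y = 0 ∨ N x y = 1)
    (hrow : ∀ x, ∑ y, N x y = 333) (hpair : ∀ x x', x ≠ x' → ∑ y, N x y * N x' y = 166)
    (hcol : ∀ y, ∑ x, N x y = 333) (hcpair : ∀ y y', y ≠ y' → ∑ x, N x y * N x y' = 166)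
    (hP : Fintype.card P = 667) (hB : Fintype.card B = 667)
    (ρ : Equiv.Perm P) (τ : Equiv.Perm B) (hN : ∀ x y, N (ρ x) (τ y) = N x y)
    (hρ : ρ ^ 37 = 1) (hτ : τ ^ 37 = 1) (x₀ : P) (hx₀ : ρ x₀ ≠ x₀) :
    ((univ.filter fun y => τ y = y).card = 1 ∧ (∀ x, ρ x = x → ∑ y ∈ univ.filter (fun y => τ y = y), N x y = 0)) ∧
    ((univ.filter fun x => ρ x = x).card = 1 ∧ (∀ y, τ y = y → ∑ x ∈ univ.filter (fun x => ρ x = x), N x y = 0)) := by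
  obtain ⟨y₀, hy₀⟩ := exists_moved_block N h01 hrow hpair ρ τ hN hx₀
  exact ⟨side37 N h01 hrow hpair hB ρ τ hN hρ hτ x₀ hx₀,
    side37 (fun y x => N x y) (fun y x => h01 x y) hcol hcpair hP τ ρ (fun y x => hN x y) hτ hρ y₀ hy₀⟩

/-- one side, `p = 23`: either no fixed block, or `23` fixed blocks with `c = 11` and `u = 5` -/
lemma side23 (N : P → B → ℤ) (h01 : ∀ x y, N x y = 0 ∨ N x y = 1)
    (hrow : ∀ x, ∑ y, N x y = 333) (hpair : ∀ x x', x ≠ x' → ∑ y, N x y * N x' y = 166)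
    (hB : Fintype.card B = 667)
    (ρ : Equiv.Perm P) (τ : Equiv.Perm B) (hN : ∀ x y, N (ρ x) (τ y) = N x y)
    (hρ : ρ ^ 23 = 1) (hτ : τ ^ 23 = 1) (x₀ : P) (hx₀ : ρ x₀ ≠ x₀) :
    (univ.filter fun y => τ y = y).card = 0 ∨
    ((univ.filter fun y => τ y = y).card = 23 ∧
      (∀ x, ρ x = x → ∑ y ∈ univ.filter (fun y => τ y = y), N x y = 11) ∧
      (∀ x x', ρ x = x → ρ x' = x' → x ≠ x' → ∑ y ∈ univ.filter (fun y => τ y = y), N x y * N x' y = 5)) := by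
  have hp : (23 : ℕ).Prime := by norm_num
  obtain ⟨hm1, σ, cs⟩ := orbitCount_cs N h01 hrow hpair 23 hp ρ τ hN hρ hτ x₀ hx₀
  have hcnt := card_fixed_add_classes τ hp hτ
  rw [hB] at hcnt
  set m := (blockClasses τ 23).card with hmdef
  have hm : m = 28 ∨ m = 29 := by
    by_contra hne
    exact cs_contra m 23 σ (by exact_mod_cast cs)
      (cs23 m (Finset.mem_range.mpr (by omega)) hm1 (fun h => hne (Or.inl h)) (fun h => hne (Or.inr h)))
  rcases hm with hm | hm
  · right
    have hF : (univ.filter fun y => τ y = y).card = 23 := by omega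
    refine ⟨hF, fun x hx => ?_, fun x x' hx hx' hxx' => ?_⟩
    · obtain ⟨a, ha⟩ := fixedPoint_row N hrow hp ρ τ hN hτ hx
      obtain ⟨c0, c1⟩ := fixedCount_bounds N h01 τ x
      rw [hF] at c1; push_cast at ha c1; omega
    · obtain ⟨a, ha⟩ := fixedPoint_row N hrow hp ρ τ hN hτ hx
      obtain ⟨c0, c1⟩ := fixedCount_bounds N h01 τ x
      obtain ⟨t, ht⟩ := fixedPair N hp ρ τ hN hτ hx hx' (hpair x x' hxx')
      obtain ⟨u0, u1⟩ := pairCount_bounds N h01 τ x x'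
      rw [hF] at c1; push_cast at ha c1 ht; omega
  · left; omega

/-- **Order 23: both sides fixed-point-free (`29 + 29` orbits), or both sides with `23` fixed elements and the parameters
`c = 11`, `u = 5` of a symmetric `2-(23,11,5)` structure; the mixed case is impossible.** -/
theorem fixedSubstructure_23 (N : P → B → ℤ) (h01 : ∀ x y, N x y = 0 ∨ N x y = 1)
    (hrow : ∀ x, ∑ y, N x y = 333) (hpair : ∀ x x', x ≠ x' → ∑ y, N x y * N x' y = 166)
    (hcol : ∀ y, ∑ x, N x y = 333) (hcpair : ∀ y y', y ≠ y' → ∑ x, N x y * N x y' = 166)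
    (hP : Fintype.card P = 667) (hB : Fintype.card B = 667)
    (ρ : Equiv.Perm P) (τ : Equiv.Perm B) (hN : ∀ x y, N (ρ x) (τ y) = N x y)
    (hρ : ρ ^ 23 = 1) (hτ : τ ^ 23 = 1) (x₀ : P) (hx₀ : ρ x₀ ≠ x₀) :
    ((univ.filter fun y => τ y = y).card = 0 ∧ (univ.filter fun x => ρ x = x).card = 0) ∨
    (((univ.filter fun y => τ y = y).card = 23 ∧
      (∀ x, ρ x = x → ∑ y ∈ univ.filter (fun y => τ y = y), N x y = 11) ∧
      (∀ x x', ρ x = x → ρ x' = x' → x ≠ x' → ∑ y ∈ univ.filter (fun y => τ y = y), N x y * N x' y = 5)) ∧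
     ((univ.filter fun x => ρ x = x).card = 23 ∧
      (∀ y, τ y = y → ∑ x ∈ univ.filter (fun x => ρ x = x), N x y = 11) ∧
      (∀ y y', τ y = y → τ y' = y' → y ≠ y' → ∑ x ∈ univ.filter (fun x => ρ x = x), N x y * N x y' = 5))) := by
  have hp : (23 : ℕ).Prime := by norm_num
  obtain ⟨y₀, hy₀⟩ := exists_moved_block N h01 hrow hpair ρ τ hN hx₀
  have hBside := side23 N h01 hrow hpair hB ρ τ hN hρ hτ x₀ hx₀
  have hPside := side23 (fun y x => N x y) (fun y x => h01 x y) hcol hcpair hP τ ρ (fun y x => hN x y) hτ hρ y₀ hy₀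
  rcases hBside with hB0 | ⟨hB23, hcB, huB⟩ <;> rcases hPside with hP0 | ⟨hP23, hcP, huP⟩
  · exact Or.inl ⟨hB0, hP0⟩
  · -- 23 fixed points but no fixed block: a fixed point lies on c ≡ 11 (mod 23) fixed blocks, c ≤ 0
    exfalso
    obtain ⟨x, hx⟩ : (univ.filter fun x => ρ x = x).Nonempty := Finset.card_pos.mp (by omega)
    have hxfix : ρ x = x := (Finset.mem_filter.mp hx).2
    obtain ⟨a, ha⟩ := fixedPoint_row N hrow hp ρ τ hN hτ hxfix
    obtain ⟨c0, c1⟩ := fixedCount_bounds N h01 τ x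
    rw [hB0] at c1; push_cast at ha c1; omega
  · exfalso
    obtain ⟨y, hy⟩ : (univ.filter fun y => τ y = y).Nonempty := Finset.card_pos.mp (by omega)
    have hyfix : τ y = y := (Finset.mem_filter.mp hy).2
    obtain ⟨a, ha⟩ := fixedPoint_row (fun y x => N x y) hcol hp τ ρ (fun y x => hN x y) hρ hyfix
    obtain ⟨c0, c1⟩ := fixedCount_bounds (fun y x => N x y) (fun y x => h01 x y) ρ y
    rw [hP0] at c1; push_cast at ha c1; omega
  · exact Or.inr ⟨⟨hB23, hcB, huB⟩, hP23, hcP, huP⟩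

end Summit.Ventures.DiscreteObjects.Hadamard
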